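import Summits.QuantumFields.QCD.Theses.SpectralDefectExtinction

/-!
# Route SpectralDefectExtinction — support item `AFBookkeeping` (stmt-QuantumFields-8972)

The **entropy dictionary of asymptotic freedom** (card L3 of the route): along an asymptotically
scaling lattice-QCD scheme (`QCDScheme.HasAsymptoticScaling`: `β_k − afBeta N_f Λ a_k → 0` for some
`Λ > 0`, with `afBeta N_f Λ a = 2b₀ℓ + 2(b₁/b₀) log ℓ`, `ℓ = log(1/(a²Λ²))`, `β = 2/g₀²` in the
tree's normalisation) and for `N_f ≤ 16` (so `b₀ = betaCoeff₀ N_f > 0`),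

  `log a_k⁻⁴ = β_k/b₀ − (2b₁/b₀²) log β_k + O(1)`   (`k → ∞`),

i.e. the number of lattice sites per physical four-volume is `e^{β/b₀}` up to a power of `β`
(Montvay–Münster, *Quantum Fields on a Lattice* (1994) §3.3.3 (3.263)–(3.265), §5.1 (5.66)–(5.67);
Creutz (13.19)).

Proof (elementary real analysis, no named facts).  Write `ε_k = β_k − afBeta N_f Λ a_k → 0` and
`ℓ_k = log(1/(a_k²Λ²)) → +∞` (`a_k → 0⁺`).  Exactly, `log a_k⁻⁴ = 2ℓ_k + 4 log Λ` and
`β_k/b₀ = 2ℓ_k + (2b₁/b₀²) log ℓ_k + ε_k/b₀`, so eventually (once `ℓ_k > 0` and `β_k ≠ 0`)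

  `log a_k⁻⁴ − β_k/b₀ + (2b₁/b₀²) log β_k = 4 log Λ − ε_k/b₀ + (2b₁/b₀²) log(β_k/ℓ_k)`.

Since `β_k/ℓ_k = 2b₀ + 2(b₁/b₀)(log ℓ_k)/ℓ_k + ε_k/ℓ_k → 2b₀ > 0`, the right-hand side converges to
`4 log Λ + (2b₁/b₀²) log(2b₀)`, and a convergent real sequence is eventually bounded in absolute
value.
-/

namespace Summit.QuantumFields.QCD.Theorems

open Filter Topology
open Literature.MathematicalPhysics.QuantumFieldTheory

/-- Asymptotic freedom of the one-loop coefficient: `b₀ = (11 − 2N_f/3)/(16π²) > 0` for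
`N_f ≤ 16`. -/
theorem betaCoeff₀_pos_of_le_sixteen {Nf : ℕ} (hNf : Nf ≤ 16) : 0 < betaCoeff₀ Nf := by
  unfold betaCoeff₀
  have h : (Nf : ℝ) ≤ 16 := by exact_mod_cast hNf
  have hπ : 0 < 16 * Real.pi ^ 2 := by positivity
  exact div_pos (by linarith) hπ

/-- **Two-loop bookkeeping lemma** (pure real analysis).  If `a_k → 0` with `a_k > 0`, `Λ > 0`,
`b₀ > 0`, and `β_k − (2b₀ℓ_k + 2(b₁/b₀) log ℓ_k) → 0` where `ℓ_k = log(1/(a_k²Λ²))`, then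
`log a_k⁻⁴ − β_k/b₀ + (2b₁/b₀²) log β_k → 4 log Λ + (2b₁/b₀²) log(2b₀)`. -/
theorem tendsto_log_inv_pow_four_sub_two_loop {a β : ℕ → ℝ} {Λ b₀ b₁ : ℝ}
    (ha : ∀ k, 0 < a k) (ha0 : Tendsto a atTop (𝓝 0)) (hΛ : 0 < Λ) (hb₀ : 0 < b₀)
    (hε : Tendsto (fun k => β k - (2 * b₀ * Real.log (1 / (a k ^ 2 * Λ ^ 2)) +
      2 * (b₁ / b₀) * Real.log (Real.log (1 / (a k ^ 2 * Λ ^ 2))))) atTop (𝓝 0)) :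
    Tendsto (fun k => Real.log ((a k)⁻¹ ^ 4) - β k / b₀ + (2 * b₁ / b₀ ^ 2) * Real.log (β k))
      atTop (𝓝 (4 * Real.log Λ + (2 * b₁ / b₀ ^ 2) * Real.log (2 * b₀))) := by
  -- the large logarithm `ℓ_k = log(1/(a_k²Λ²))` and the remainder `ε_k`
  obtain ⟨ℓ, hℓ_def⟩ : ∃ ℓ : ℕ → ℝ, ∀ k, ℓ k = Real.log (1 / (a k ^ 2 * Λ ^ 2)) := ⟨_, fun _ => rfl⟩
  obtain ⟨ε, hε_def⟩ : ∃ ε : ℕ → ℝ, ∀ k,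
      ε k = β k - (2 * b₀ * ℓ k + 2 * (b₁ / b₀) * Real.log (ℓ k)) := ⟨_, fun _ => rfl⟩
  have hε' : Tendsto ε atTop (𝓝 0) := by
    refine hε.congr' (Eventually.of_forall fun k => ?_)
    rw [hε_def, hℓ_def]
  -- `ℓ_k → +∞`
  have hℓ : Tendsto ℓ atTop atTop := by
    have h1 : Tendsto (fun k => a k ^ 2 * Λ ^ 2) atTop (𝓝[>] 0) := by
      refine tendsto_nhdsWithin_iff.mpr ⟨?_, Eventually.of_forall fun k => ?_⟩
      · simpa using (ha0.pow 2).mul_const (Λ ^ 2)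
      · have := ha k
        show 0 < a k ^ 2 * Λ ^ 2
        positivity
    have h2 := Real.tendsto_log_atTop.comp h1.inv_tendsto_nhdsGT_zero
    refine h2.congr' (Eventually.of_forall fun k => ?_)
    simp [hℓ_def, one_div]
  have hℓpos : ∀ᶠ k in atTop, 0 < ℓ k := hℓ.eventually_gt_atTop 0
  -- the decomposition of `β_k` and the exact identity for `log a_k⁻⁴`
  have hβ : ∀ k, β k = 2 * b₀ * ℓ k + 2 * (b₁ / b₀) * Real.log (ℓ k) + ε k := fun k => by
    rw [hε_def]; ring
  have hloga : ∀ k, Real.log ((a k)⁻¹ ^ 4) = 2 * ℓ k + 4 * Real.log Λ := fun k => by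
    have hak : a k ≠ 0 := (ha k).ne'
    rw [hℓ_def, Real.log_pow, Real.log_inv, one_div, Real.log_inv,
      Real.log_mul (pow_ne_zero 2 hak) (pow_ne_zero 2 hΛ.ne'), Real.log_pow, Real.log_pow]
    push_cast
    ring
  -- `β_k/ℓ_k → 2b₀`
  have hratio : Tendsto (fun k => β k / ℓ k) atTop (𝓝 (2 * b₀)) := by
    have h1 : Tendsto (fun k => Real.log (ℓ k) / ℓ k) atTop (𝓝 0) :=
      Real.isLittleO_log_id_atTop.tendsto_div_nhds_zero.comp hℓ
    have h2 : Tendsto (fun k => ε k / ℓ k) atTop (𝓝 0) := hε'.div_atTop hℓ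
    have h3 : Tendsto (fun k => 2 * b₀ + 2 * (b₁ / b₀) * (Real.log (ℓ k) / ℓ k) + ε k / ℓ k) atTop
        (𝓝 (2 * b₀ + 2 * (b₁ / b₀) * 0 + 0)) :=
      ((h1.const_mul _).const_add _).add h2
    rw [mul_zero, add_zero, add_zero] at h3
    refine h3.congr' ?_
    filter_upwards [hℓpos] with k hk
    rw [hβ k]
    field_simp
  -- eventually `β_k ≠ 0`
  have hβne : ∀ᶠ k in atTop, β k ≠ 0 := by
    filter_upwards [hratio.eventually_const_lt (show b₀ < 2 * b₀ by linarith)] with k hk h0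
    rw [h0, zero_div] at hk
    exact absurd hk (not_lt.mpr hb₀.le)
  -- `log(β_k/ℓ_k) → log(2b₀)`
  have hlog : Tendsto (fun k => Real.log (β k / ℓ k)) atTop (𝓝 (Real.log (2 * b₀))) :=
    hratio.log (by positivity)
  -- assemble
  have h1 : Tendsto (fun k => 4 * Real.log Λ - ε k / b₀ + (2 * b₁ / b₀ ^ 2) * Real.log (β k / ℓ k))
      atTop (𝓝 (4 * Real.log Λ - 0 / b₀ + (2 * b₁ / b₀ ^ 2) * Real.log (2 * b₀))) :=
    ((hε'.div_const b₀).const_sub _).add (hlog.const_mul _)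
  rw [zero_div, sub_zero] at h1
  refine h1.congr' ?_
  filter_upwards [hℓpos, hβne] with k hl hb
  rw [Real.log_div hb hl.ne', hloga k, hβ k]
  field_simp
  ring

/-- **Item stmt-QuantumFields-8972 (`AFBookkeeping`), proved.** Under `HasAsymptoticScaling` with
`N_f ≤ 16`: `log a_k⁻⁴ = β_k/b₀ − (2b₁/b₀²) log β_k + O(1)`, i.e. there is `C` with
`|log a_k⁻⁴ − β_k/b₀ + (2b₁/b₀²) log β_k| ≤ C` eventually in `k` (Montvay–Münster (3.263)–(3.265);
Creutz (13.19)).  The sequence in fact converges to `4 log Λ + (2b₁/b₀²) log(2b₀)`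
(`tendsto_log_inv_pow_four_sub_two_loop`), and we take `C = |limit| + 1`. -/
theorem aFBookkeeping_proof :
    Summit.QuantumFields.QCD.Theses.SpectralDefectExtinction.AFBookkeeping := by
  unfold Summit.QuantumFields.QCD.Theses.SpectralDefectExtinction.AFBookkeeping
  intro Nf hNf sch hAS
  obtain ⟨Λ, hΛ, hε⟩ := hAS
  have hb₀ : 0 < betaCoeff₀ Nf := betaCoeff₀_pos_of_le_sixteen hNf
  have hE := tendsto_log_inv_pow_four_sub_two_loop (b₁ := betaCoeff₁ Nf) sch.a_pos sch.tendsto_a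
    hΛ hb₀ (by simpa only [afBeta] using hε)
  exact ⟨_, hE.abs.eventually_le_const (lt_add_one _)⟩

end Summit.QuantumFields.QCD.Theorems
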